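import Mathlib.Algebra.BigOperators.Fin
import Mathlib.Algebra.Order.BigOperators.Group.List
import Mathlib.Data.Fintype.Prod
import Mathlib.Data.Finset.Lattice.Fold
import Mathlib.Data.Bool.Count
import Literature.Computability.Cryptography.LCSFacts
import Literature.Computability.FineGrained.BKGadgetStructure
import HarnessLib

/-!
# The Bringmann–Künnemann alignment gadget for LCS on binary strings (BK15 §4), proved

K. Bringmann, M. Künnemann, *Quadratic conditional lower bounds for string problems and dynamic
time warping*, FOCS 2015 (arXiv:1502.01063), **§4 (Longest Common Subsequence)**, for the number
of unmatched symbols `δ_LCS(x,y) = |x| + |y| - 2|LCS(x,y)|` (`Cryptography.dLCS`) on `List Bool`: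

* Def. 4.2: parameters `γ₁ = ℓₓ+ℓ_y`, `γ₂ = 6(ℓₓ+ℓ_y)`, `γ₃ = 10(ℓₓ+ℓ_y) + 2sₓ - ℓₓ`,
  `γ₄ = 13(ℓₓ+ℓ_y)` (`Params.γ₁…γ₄`), the guarding `G(z) = 1^{γ₂} 0^{γ₁} z 0^{γ₁} 1^{γ₂}`
  (`Params.guard`), `x = G(x₁) 0^{γ₃} ⋯ 0^{γ₃} G(x_n)` (`Params.gadgetX`),
  `y = 0^{nγ₄} G(y₁) 0^{γ₃} ⋯ G(y_m) 0^{nγ₄}` (`Params.gadgetY`), `C = 2nγ₄` (`Params.C`);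
* the cost of alignments for `δ_LCS` (`maxDistL`, `alignCostL`, `structuredCostL`; the notion
  of alignment is `BKGadget.IsAlignment`, BK15 §3; the blocks `zeros`/`ones` and their counting
  lemmas are `BKGadget`'s);
* **Lemma 4.3, proved** (`alignmentGadget_dLCS`): `(x, y, C)` realises an alignment gadget
  (BK15 Def. 3.1) — every structured alignment bounds `δ(x,y) - C` from above
  (`dLCS_gadget_le_structuredCost`), some alignment bounds it from below
  (`exists_alignment_le_dLCS_gadget`) — via Claim 4.6 (prefix balance, `count_take_gadgetX`),
  Claim 4.7 (`dLCS_le_dLCS_slice_guard`) and Claim 4.8 (`add_le_dLCS_slice_guard`).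

Side conditions (all satisfied by the three uses in BK15 §3.1, cf. `BKGadget`'s discussion for
edit distance): `1 ≤ m ≤ n`, the `xᵢ` of one type `(ℓₓ, sₓ)` with `1 ≤ ℓₓ`, the `yⱼ` of one
length `ℓ_y ≥ ℓₓ` (implicit in print: the proof of Claim 4.7 writes the piece facing `G(yⱼ)` as
`1^{r_L} 0^{γ₁} xᵢ 0^{γ₁} 1^{r_R}` once it is longer than `|G(yⱼ)| - γ₂ = γ₂ + 2γ₁ + ℓ_y`, which
needs `ℓ_y ≥ ℓₓ`).
-/

namespace Literature.Computability.FineGrained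

open Cryptography BKGadget
open scoped List

namespace BKLCS

/-! ### Slices of a list -/

section slice

variable {α : Type*}

/-- The contiguous piece `x[a .. a+l)` of a list `x`. [folklore] -/
def slice (a l : ℕ) (x : List α) : List α := (x.drop a).take l

/-- A slice inside the list has the requested length. [folklore] -/
theorem length_slice {a l : ℕ} {x : List α} (h : a + l ≤ x.length) : (slice a l x).length = l := by
  simp only [slice, List.length_take, List.length_drop]; omega

/-- Any slice has length at most the requested length. [folklore] -/
theorem length_slice_le (a l : ℕ) (x : List α) : (slice a l x).length ≤ l := by
  simp only [slice, List.length_take]; omega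

/-- A slice inside the left summand. [folklore] -/
theorem slice_append_left {a l : ℕ} (A B : List α) (h : a + l ≤ A.length) :
    slice a l (A ++ B) = slice a l A := by
  simp only [slice, List.drop_append, List.take_append, List.length_drop]
  have : l - (A.length - a) = 0 := by omega
  simp [this]

/-- A slice inside the right summand. [folklore] -/
theorem slice_append_right {a l : ℕ} (A B : List α) (h : A.length ≤ a) :
    slice a l (A ++ B) = slice (a - A.length) l B := by
  simp only [slice, List.drop_append, List.drop_eq_nil_of_le h, List.nil_append]

/-- A slice inside the middle summand. [folklore] -/
theorem slice_append_mid {a l : ℕ} (A B C : List α) (h₁ : A.length ≤ a)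
    (h₂ : a + l ≤ A.length + B.length) :
    slice a l (A ++ B ++ C) = slice (a - A.length) l B := by
  rw [List.append_assoc, slice_append_right _ _ h₁, slice_append_left _ _ (by omega)]

/-- A slice covering the middle summand. [folklore] -/
theorem slice_append_covering {a l : ℕ} (A B C : List α) (h₁ : a ≤ A.length)
    (h₂ : A.length + B.length ≤ a + l) :
    slice a l (A ++ B ++ C) = A.drop a ++ B ++ C.take (a + l - A.length - B.length) := by
  have e1 : a - A.length = 0 := by omega
  simp only [slice, List.append_assoc, List.drop_append, e1, List.drop_zero, List.take_append,
    List.length_drop, Nat.zero_sub]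
  have e2 : l - (A.length - a) - B.length = a + l - A.length - B.length := by omega
  rw [List.take_of_length_le (l := A.drop a) (by simp; omega),
    List.take_of_length_le (l := B) (by omega), e2]

/-- The whole list as a slice. [folklore] -/
theorem slice_zero_length (x : List α) : slice 0 x.length x = x := by
  simp [slice]

/-- A prefix as a slice. [folklore] -/
theorem slice_zero (l : ℕ) (x : List α) : slice 0 l x = x.take l := by
  simp [slice]

/-- Nested slices: the inner one is a sublist (indeed an infix) of the outer one. [folklore] -/
theorem slice_sublist_slice {a l a₀ l₀ : ℕ} (x : List α) (h₁ : a₀ ≤ a) (h₂ : a + l ≤ a₀ + l₀) :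
    slice a l x <+ slice a₀ l₀ x := by
  obtain ⟨d, rfl⟩ := Nat.exists_eq_add_of_le h₁
  have e1 : slice (a₀ + d) l x = ((x.drop a₀).drop d).take l := by
    simp [slice, List.drop_drop]
  have e2 : slice a₀ (d + l) x = (x.drop a₀).take d ++ ((x.drop a₀).drop d).take l := by
    simp [slice, List.take_add]
  have h3 : slice a₀ (d + l) x <+ slice a₀ l₀ x := by
    have : slice a₀ (d + l) x = (slice a₀ l₀ x).take (d + l) := by
      simp only [slice, List.take_take]; congr 1; omega
    rw [this]; exact List.take_sublist _ _
  refine List.Sublist.trans ?_ h3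
  rw [e1, e2]; exact List.sublist_append_right _ _

/-- A slice of a constant list is constant. [folklore] -/
theorem slice_replicate (a l k : ℕ) (c : α) :
    slice a l (List.replicate k c) = List.replicate (min l (k - a)) c := by
  simp [slice, List.drop_replicate, List.take_replicate]

/-- Splitting a slice in two consecutive slices. [folklore] -/
theorem slice_add (a l₁ l₂ : ℕ) (x : List α) :
    slice a (l₁ + l₂) x = slice a l₁ x ++ slice (a + l₁) l₂ x := by
  simp [slice, List.take_add, List.drop_drop]

end slice

/-! ### Bit counting -/

/-- A bit string has as many symbols as ones plus zeros. [folklore] -/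
theorem length_eq_count_add_count (l : List Bool) : l.length = l.count true + l.count false := by
  have := List.count_not_add_count l true
  simp only [Bool.not_true] at this
  omega

/-- Counting in a prefix of a concatenation. [folklore] -/
theorem count_take_append (b : Bool) (r : ℕ) (A B : List Bool) :
    (List.take r (A ++ B)).count b = (A.take r).count b + (B.take (r - A.length)).count b := by
  rw [List.take_append, List.count_append]

/-- Counting in a prefix of a constant block. [folklore] -/
theorem count_take_replicate (b c : Bool) (r k : ℕ) :
    (List.take r (List.replicate k c)).count b = if c = b then min r k else 0 := by
  rw [List.take_replicate, List.count_replicate]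
  by_cases h : c = b <;> simp [h]

/-- Ones in a prefix of `1^k`. [folklore] -/
@[simp] theorem count_true_take_ones (r k : ℕ) : ((ones k).take r).count true = min r k := by
  simp [ones, List.take_replicate]

/-- No zeros in a prefix of `1^k`. [folklore] -/
@[simp] theorem count_false_take_ones (r k : ℕ) : ((ones k).take r).count false = 0 := by
  simp [ones, List.take_replicate, List.count_replicate]

/-- No ones in a prefix of `0^k`. [folklore] -/
@[simp] theorem count_true_take_zeros (r k : ℕ) : ((zeros k).take r).count true = 0 := by
  simp [zeros, List.take_replicate, List.count_replicate]

/-- Zeros in a prefix of `0^k`. [folklore] -/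
@[simp] theorem count_false_take_zeros (r k : ℕ) : ((zeros k).take r).count false = min r k := by
  simp [zeros, List.take_replicate]

/-- `1^{a+b} = 1^a 1^b`. [folklore] -/
theorem ones_add (a b : ℕ) : ones (a + b) = ones a ++ ones b := by
  simp only [ones, List.replicate_append_replicate]

/-- `0^{a+b} = 0^a 0^b`. [folklore] -/
theorem zeros_add (a b : ℕ) : zeros (a + b) = zeros a ++ zeros b := by
  simp only [zeros, List.replicate_append_replicate]

/-- A prefix of a bit string has at most as many ones. [folklore] -/
theorem count_take_le (b : Bool) (r : ℕ) (z : List Bool) : (z.take r).count b ≤ z.count b :=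
  (List.take_sublist r z).count_le b

/-! ### The cost of alignments for `δ_LCS` (BK15 §3) -/

section cost

variable {n m : ℕ}

/-- `maxᵢⱼ δ_LCS(xᵢ, yⱼ)`, the punishment for an unaligned `j` (BK15 §3).
[cite: BringmannKunnemannFOCS2015, §3 (Alignments)] -/
def maxDistL (x : Fin n → List Bool) (y : Fin m → List Bool) : ℕ :=
  Finset.univ.sup fun p : Fin n × Fin m => dLCS (x p.1) (y p.2)

/-- The cost of an alignment `A` for `δ_LCS`:
`δ(A) = ∑_{(i,j) ∈ A} δ(xᵢ,yⱼ) + (m - |A|) · maxᵢⱼ δ(xᵢ,yⱼ)` (BK15 §3).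
[cite: BringmannKunnemannFOCS2015, §3 (Alignments)] -/
def alignCostL (x : Fin n → List Bool) (y : Fin m → List Bool) (A : List (Fin n × Fin m)) : ℕ :=
  (A.map fun p => dLCS (x p.1) (y p.2)).sum + (m - A.length) * maxDistL x y

/-- The cost of the structured alignment `{(Δ+1,1),…,(Δ+m,m)}` for `δ_LCS` (BK15 §3).
[cite: BringmannKunnemannFOCS2015, §3 (Alignments)] -/
def structuredCostL (x : Fin n → List Bool) (y : Fin m → List Bool) (Δ : ℕ) (hΔ : Δ + m ≤ n) :
    ℕ :=
  ∑ j : Fin m, dLCS (x ⟨Δ + j, by omega⟩) (y j)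

/-- Every distance is at most the punishment term. [folklore] -/
theorem dLCS_le_maxDistL (x : Fin n → List Bool) (y : Fin m → List Bool) (i : Fin n) (j : Fin m) :
    dLCS (x i) (y j) ≤ maxDistL x y :=
  Finset.le_sup (f := fun p : Fin n × Fin m => dLCS (x p.1) (y p.2)) (Finset.mem_univ (i, j))

/-- The punishment term is bounded by any common bound of the distances. [folklore] -/
theorem maxDistL_le {x : Fin n → List Bool} {y : Fin m → List Bool} {c : ℕ}
    (h : ∀ i j, dLCS (x i) (y j) ≤ c) : maxDistL x y ≤ c :=
  Finset.sup_le fun p _ => h p.1 p.2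

end cost

/-! ### The gadget (BK15 Def. 4.2) -/

/-- The data the gadget depends on (BK15 Lemma/Def. 4.2): the common type `(ℓₓ, sₓ)` of the
`xᵢ` and the common length `ℓ_y` of the `yⱼ`. [cite: BringmannKunnemannFOCS2015, Definition 4.2] -/
structure Params where
  /-- Common length `ℓₓ` of the `xᵢ`. -/
  ℓx : ℕ
  /-- Common length `ℓ_y` of the `yⱼ`. -/
  ℓy : ℕ
  /-- Common number of ones `sₓ` of the `xᵢ`. -/
  sx : ℕ

namespace Params

variable (P : Params)

/-- `γ₁ := ℓₓ + ℓ_y` (BK15 Def. 4.2). [cite: BringmannKunnemannFOCS2015, Definition 4.2] -/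
def γ₁ : ℕ := P.ℓx + P.ℓy

/-- `γ₂ := 6(ℓₓ + ℓ_y)` (BK15 Def. 4.2). [cite: BringmannKunnemannFOCS2015, Definition 4.2] -/
def γ₂ : ℕ := 6 * (P.ℓx + P.ℓy)

/-- `γ₃ := 10(ℓₓ + ℓ_y) + 2sₓ - ℓₓ` (BK15 Def. 4.2; the subtraction never truncates).
[cite: BringmannKunnemannFOCS2015, Definition 4.2] -/
def γ₃ : ℕ := 10 * (P.ℓx + P.ℓy) + 2 * P.sx - P.ℓx

/-- `γ₄ := 13(ℓₓ + ℓ_y)` (BK15 Def. 4.2). [cite: BringmannKunnemannFOCS2015, Definition 4.2] -/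
def γ₄ : ℕ := 13 * (P.ℓx + P.ℓy)

/-- The guarding `G(z) := 1^{γ₂} 0^{γ₁} z 0^{γ₁} 1^{γ₂}` (BK15 Def. 4.2).
[cite: BringmannKunnemannFOCS2015, Definition 4.2] -/
def guard (z : List Bool) : List Bool :=
  ones P.γ₂ ++ (zeros P.γ₁ ++ (z ++ (zeros P.γ₁ ++ ones P.γ₂)))

/-- `x := G(x₁) 0^{γ₃} G(x₂) 0^{γ₃} ⋯ 0^{γ₃} G(x_n)` (BK15 Def. 4.2); the same interleaving is
the core of `y`. [cite: BringmannKunnemannFOCS2015, Definition 4.2] -/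
def gadgetX : List (List Bool) → List Bool
  | [] => []
  | [z] => P.guard z
  | z :: z' :: zs => P.guard z ++ (zeros P.γ₃ ++ gadgetX (z' :: zs))

/-- `y := 0^{nγ₄} G(y₁) 0^{γ₃} ⋯ 0^{γ₃} G(y_m) 0^{nγ₄}` (BK15 Def. 4.2; `n` = number of `xᵢ`).
[cite: BringmannKunnemannFOCS2015, Definition 4.2] -/
def gadgetY (n : ℕ) (ys : List (List Bool)) : List Bool :=
  zeros (n * P.γ₄) ++ (P.gadgetX ys ++ zeros (n * P.γ₄))

/-- The offset `C := 2nγ₄` (BK15, proof of Lemma 4.3). [cite: BringmannKunnemannFOCS2015, Lemma 4.3 (proof)] -/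
def C (n : ℕ) : ℕ := 2 * (n * P.γ₄)

/-- One period of `x`: `G(z) 0^{γ₃}`. [folklore] -/
def blockZ (z : List Bool) : List Bool := P.guard z ++ zeros P.γ₃

/-- `G(z₁) 0^{γ₃} G(z₂) 0^{γ₃} ⋯ G(z_k) 0^{γ₃}` (every block followed by its zero block). [folklore] -/
def blocksZ (zs : List (List Bool)) : List Bool := (zs.map P.blockZ).flatten

/-- `0^{γ₃} G(z₁) 0^{γ₃} G(z₂) ⋯ 0^{γ₃} G(z_k)` (every block preceded by a zero block). [folklore] -/
def Zblocks (zs : List (List Bool)) : List Bool := (zs.map fun z => zeros P.γ₃ ++ P.guard z).flatten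

/-- The neighbourhood `0^{γ₃} G(z) 0^{γ₃}` of a block inside `0^{γ₃} x 0^{γ₃}`. [folklore] -/
def mid (z : List Bool) : List Bool := zeros P.γ₃ ++ (P.guard z ++ zeros P.γ₃)

/-- The period `|G(xᵢ) 0^{γ₃}| = 2γ₂ + 2γ₁ + ℓₓ + γ₃`. [folklore] -/
def per : ℕ := 2 * P.γ₂ + 2 * P.γ₁ + P.ℓx + P.γ₃

/-- The position of `xᵢ` inside `x`: `cpos i = i · per + γ₂ + γ₁`. [folklore] -/
def cpos (i : ℕ) : ℕ := i * P.per + P.γ₂ + P.γ₁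

/-! #### Elementary equations -/

/-- `gadgetX` of a list with at least two blocks. [folklore] -/
theorem gadgetX_cons_cons (z z' : List Bool) (zs : List (List Bool)) :
    P.gadgetX (z :: z' :: zs) = P.guard z ++ (zeros P.γ₃ ++ P.gadgetX (z' :: zs)) := rfl

/-- `gadgetX` of a nonempty tail. [folklore] -/
theorem gadgetX_cons {zs : List (List Bool)} (hzs : zs ≠ []) (z : List Bool) :
    P.gadgetX (z :: zs) = P.guard z ++ (zeros P.γ₃ ++ P.gadgetX zs) := by
  obtain ⟨z', zs', rfl⟩ := List.exists_cons_of_ne_nil hzs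
  rfl

/-- Prepending blocks: `gadgetX (as ++ bs) = blocksZ as ++ gadgetX bs` for `bs ≠ []`. [folklore] -/
theorem gadgetX_append_left (as : List (List Bool)) {bs : List (List Bool)} (hbs : bs ≠ []) :
    P.gadgetX (as ++ bs) = P.blocksZ as ++ P.gadgetX bs := by
  induction as with
  | nil => simp [blocksZ]
  | cons a as ih =>
      rw [List.cons_append, P.gadgetX_cons (by simp [hbs]), ih]
      simp [blocksZ, blockZ, List.append_assoc]

/-- `0^{γ₃} x = Zblocks xs` for nonempty `xs`. [folklore] -/
theorem zeros_append_gadgetX {cs : List (List Bool)} (hcs : cs ≠ []) :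
    zeros P.γ₃ ++ P.gadgetX cs = P.Zblocks cs := by
  induction cs with
  | nil => exact absurd rfl hcs
  | cons c cs ih =>
      rcases cs with _ | ⟨c', cs⟩
      · simp [gadgetX, Zblocks]
      · rw [P.gadgetX_cons_cons, ← List.append_assoc, ih (by simp)]
        simp [Zblocks]

/-- Appending blocks: `gadgetX (bs ++ cs) = gadgetX bs ++ Zblocks cs` for `bs ≠ []`. [folklore] -/
theorem gadgetX_append_right {bs : List (List Bool)} (hbs : bs ≠ []) (cs : List (List Bool)) :
    P.gadgetX (bs ++ cs) = P.gadgetX bs ++ P.Zblocks cs := by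
  induction bs with
  | nil => exact absurd rfl hbs
  | cons b bs ih =>
      rcases bs with _ | ⟨b', bs⟩
      · rcases eq_or_ne cs [] with rfl | hcs
        · simp [gadgetX, Zblocks]
        · rw [List.singleton_append, P.gadgetX_cons hcs, ← P.zeros_append_gadgetX hcs]; rfl
      · rw [List.cons_append, List.cons_append, P.gadgetX_cons_cons, P.gadgetX_cons_cons,
          ← List.cons_append, ih (by simp)]
        simp only [List.append_assoc]

/-- `x 0^{γ₃} = blocksZ xs` for nonempty `xs`. [folklore] -/
theorem gadgetX_append_zeros {zs : List (List Bool)} (hzs : zs ≠ []) :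
    P.gadgetX zs ++ zeros P.γ₃ = P.blocksZ zs := by
  induction zs with
  | nil => exact absurd rfl hzs
  | cons z zs ih =>
      rcases zs with _ | ⟨z', zs⟩
      · simp [gadgetX, blocksZ, blockZ]
      · rw [P.gadgetX_cons_cons, List.append_assoc, List.append_assoc, ih (by simp)]
        simp [blocksZ, blockZ, List.append_assoc]

/-- The shift identity `0^{γ₃} blocksZ zs = Zblocks zs 0^{γ₃}`. [folklore] -/
theorem zeros_append_blocksZ (zs : List (List Bool)) :
    zeros P.γ₃ ++ P.blocksZ zs = P.Zblocks zs ++ zeros P.γ₃ := by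
  induction zs with
  | nil => simp [blocksZ, Zblocks]
  | cons z zs ih =>
      simp only [blocksZ, Zblocks, List.map_cons, List.flatten_cons] at ih ⊢
      simp only [blockZ, List.append_assoc]
      rw [ih]

/-- `blocksZ` of a concatenation. [folklore] -/
theorem blocksZ_append (as bs : List (List Bool)) :
    P.blocksZ (as ++ bs) = P.blocksZ as ++ P.blocksZ bs := by
  simp [blocksZ]

/-- `Zblocks` of a concatenation. [folklore] -/
theorem Zblocks_append (as bs : List (List Bool)) :
    P.Zblocks (as ++ bs) = P.Zblocks as ++ P.Zblocks bs := by
  simp [Zblocks]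

/-! #### Lengths -/

/-- `|G(z)| = 2γ₂ + 2γ₁ + |z|`. [folklore] -/
@[simp] theorem length_guard (z : List Bool) :
    (P.guard z).length = 2 * P.γ₂ + 2 * P.γ₁ + z.length := by
  simp only [guard, List.length_append, length_ones, length_zeros]; ring

/-- `|G(z) 0^{γ₃}| = per` for `|z| = ℓₓ`. [folklore] -/
theorem length_blockZ {z : List Bool} (hz : z.length = P.ℓx) : (P.blockZ z).length = P.per := by
  simp [blockZ, per, hz]

/-- `|blocksZ zs| = |zs| · per` for blocks of length `ℓₓ`. [folklore] -/
theorem length_blocksZ {zs : List (List Bool)} (h : ∀ z ∈ zs, z.length = P.ℓx) :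
    (P.blocksZ zs).length = zs.length * P.per := by
  induction zs with
  | nil => simp [blocksZ]
  | cons z zs ih =>
      have ih' := ih fun w hw => h w (by simp [hw])
      simp only [blocksZ, List.map_cons, List.flatten_cons, List.length_append] at ih' ⊢
      rw [ih', P.length_blockZ (h z (by simp)), List.length_cons]; ring

/-- `|Zblocks zs| = |zs| · per` for blocks of length `ℓₓ`. [folklore] -/
theorem length_Zblocks {zs : List (List Bool)} (h : ∀ z ∈ zs, z.length = P.ℓx) :
    (P.Zblocks zs).length = zs.length * P.per := by
  have h1 := congrArg List.length (P.zeros_append_blocksZ zs)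
  simp only [List.length_append, length_zeros, P.length_blocksZ h] at h1
  omega

/-- `|x| + γ₃ = n · per` for `n ≥ 1` blocks of length `ℓₓ`. [folklore] -/
theorem length_gadgetX_add {zs : List (List Bool)} (hzs : zs ≠ []) (h : ∀ z ∈ zs, z.length = P.ℓx) :
    (P.gadgetX zs).length + P.γ₃ = zs.length * P.per := by
  have h1 := congrArg List.length (P.gadgetX_append_zeros hzs)
  simp only [List.length_append, length_zeros, P.length_blocksZ h] at h1
  exact h1

/-- `|x|` for blocks of a common length `ℓ` (any `ℓ`): `n (2γ₂ + 2γ₁ + ℓ) + (n - 1) γ₃`. [folklore] -/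
theorem length_gadgetX {ℓ : ℕ} (zs : List (List Bool)) (h : ∀ z ∈ zs, z.length = ℓ) :
    (P.gadgetX zs).length = zs.length * (2 * P.γ₂ + 2 * P.γ₁ + ℓ) + (zs.length - 1) * P.γ₃ := by
  induction zs with
  | nil => simp [gadgetX]
  | cons z zs ih =>
      have hz : z.length = ℓ := h z (by simp)
      have h' : ∀ w ∈ zs, w.length = ℓ := fun w hw => h w (by simp [hw])
      rcases zs with _ | ⟨w, zs⟩
      · simp [gadgetX, hz]
      · rw [P.gadgetX_cons_cons, List.length_append, List.length_append, ih h', P.length_guard,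
          hz, length_zeros]
        simp only [List.length_cons, Nat.add_sub_cancel]
        ring

/-- `|y| = 2nγ₄ + |core|`. [folklore] -/
theorem length_gadgetY (n : ℕ) (ys : List (List Bool)) :
    (P.gadgetY n ys).length = 2 * (n * P.γ₄) + (P.gadgetX ys).length := by
  simp only [gadgetY, List.length_append, length_zeros]; ring

/-- `|mid z| = per + γ₃` for `|z| = ℓₓ`. [folklore] -/
theorem length_mid {z : List Bool} (hz : z.length = P.ℓx) : (P.mid z).length = P.per + P.γ₃ := by
  simp [mid, per, hz]; ring

/-! #### Counting ones and zeros -/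

/-- Ones of `G(z)`: `2γ₂ + #₁ z`. [folklore] -/
@[simp] theorem count_true_guard (z : List Bool) : (P.guard z).count true = 2 * P.γ₂ + z.count true := by
  simp only [guard, List.count_append, count_true_ones, count_true_zeros]; ring

/-- Zeros of `G(z)`: `2γ₁ + #₀ z`. [folklore] -/
@[simp] theorem count_false_guard (z : List Bool) :
    (P.guard z).count false = 2 * P.γ₁ + z.count false := by
  simp only [guard, List.count_append, count_false_ones, count_false_zeros]; ring

/-- A block `G(z) 0^{γ₃}` of type `(ℓₓ, sₓ)` is balanced: as many ones as zeros (the choice of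
`γ₃`, BK15 proof of Claim 4.6). [cite: BringmannKunnemannFOCS2015, Claim 4.6 (proof)] -/
theorem count_blockZ {z : List Bool} (hz : z.length = P.ℓx) (hs : z.count true = P.sx) :
    (P.blockZ z).count true = 2 * P.γ₂ + P.sx ∧ (P.blockZ z).count false = 2 * P.γ₂ + P.sx := by
  have hzf : z.count false = P.ℓx - P.sx := by
    have := length_eq_count_add_count z; omega
  have hsl : P.sx ≤ P.ℓx := by rw [← hs, ← hz]; exact List.count_le_length
  have h1 : (P.blockZ z).count true = 2 * P.γ₂ + P.sx := by simp [blockZ, List.count_append, hs]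
  have h2 : (P.blockZ z).count false = 2 * P.γ₁ + (P.ℓx - P.sx) + P.γ₃ := by
    simp [blockZ, List.count_append, hzf]
  refine ⟨h1, ?_⟩
  rw [h2]; simp only [γ₁, γ₂, γ₃]; omega

/-- Ones and zeros of `blocksZ zs` for blocks of type `(ℓₓ, sₓ)`: `|zs| (2γ₂ + sₓ)` each. [folklore] -/
theorem count_blocksZ {zs : List (List Bool)} (h : ∀ z ∈ zs, z.length = P.ℓx)
    (hs : ∀ z ∈ zs, z.count true = P.sx) :
    (P.blocksZ zs).count true = zs.length * (2 * P.γ₂ + P.sx) ∧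
      (P.blocksZ zs).count false = zs.length * (2 * P.γ₂ + P.sx) := by
  induction zs with
  | nil => simp [blocksZ]
  | cons z zs ih =>
      obtain ⟨ih1, ih2⟩ := ih (fun w hw => h w (by simp [hw])) (fun w hw => hs w (by simp [hw]))
      obtain ⟨h1, h2⟩ := P.count_blockZ (h z (by simp)) (hs z (by simp))
      simp only [blocksZ, List.map_cons, List.flatten_cons, List.count_append] at ih1 ih2 ⊢
      rw [h1, ih1, h2, ih2, List.length_cons]
      constructor <;> ring

/-- Ones and zeros of `Zblocks zs` for blocks of type `(ℓₓ, sₓ)`. [folklore] -/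
theorem count_Zblocks {zs : List (List Bool)} (h : ∀ z ∈ zs, z.length = P.ℓx)
    (hs : ∀ z ∈ zs, z.count true = P.sx) :
    (P.Zblocks zs).count true = zs.length * (2 * P.γ₂ + P.sx) ∧
      (P.Zblocks zs).count false = zs.length * (2 * P.γ₂ + P.sx) := by
  obtain ⟨h1, h2⟩ := P.count_blocksZ h hs
  have e := P.zeros_append_blocksZ zs
  have e1 := congrArg (List.count true) e
  have e2 := congrArg (List.count false) e
  simp only [List.count_append, count_true_zeros, count_false_zeros] at e1 e2
  constructor <;> omega

/-! #### The extended string `0^{γ₃} x 0^{γ₃}` and its decompositions -/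

/-- `0^{γ₃} x 0^{γ₃} = 0^{γ₃} blocksZ xs`. [folklore] -/
theorem ext_eq {zs : List (List Bool)} (hzs : zs ≠ []) :
    zeros P.γ₃ ++ (P.gadgetX zs ++ zeros P.γ₃) = zeros P.γ₃ ++ P.blocksZ zs := by
  rw [P.gadgetX_append_zeros hzs]

/-- First decomposition of `0^{γ₃} x 0^{γ₃}` around block `i`:
`(0^{γ₃} blocksZ (xs[..i])) (G(xᵢ) 0^{γ₃}) (blocksZ xs[i+1..])`. [folklore] -/
theorem ext_eq_blockZ {n : ℕ} (x : Fin n → List Bool) (i : Fin n) :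
    zeros P.γ₃ ++ (P.gadgetX (List.ofFn x) ++ zeros P.γ₃) =
      (zeros P.γ₃ ++ P.blocksZ ((List.ofFn x).take i)) ++ P.blockZ (x i) ++
        P.blocksZ ((List.ofFn x).drop (i + 1)) := by
  have hne : List.ofFn x ≠ [] := by
    have : 0 < n := Fin.pos i
    simp [List.ofFn_eq_nil_iff]; omega
  rw [P.ext_eq hne]
  conv_lhs => rw [← List.take_append_drop i (List.ofFn x)]
  rw [List.drop_eq_getElem_cons (by simp), List.getElem_ofFn, P.blocksZ_append]
  simp [blocksZ, List.append_assoc]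

/-- Second decomposition of `0^{γ₃} x 0^{γ₃}` around block `i`:
`(Zblocks xs[..i]) (0^{γ₃} G(xᵢ) 0^{γ₃}) (blocksZ xs[i+1..])`. [folklore] -/
theorem ext_eq_mid {n : ℕ} (x : Fin n → List Bool) (i : Fin n) :
    zeros P.γ₃ ++ (P.gadgetX (List.ofFn x) ++ zeros P.γ₃) =
      P.Zblocks ((List.ofFn x).take i) ++ P.mid (x i) ++ P.blocksZ ((List.ofFn x).drop (i + 1)) := by
  rw [P.ext_eq_blockZ x i, P.zeros_append_blocksZ]
  simp [mid, blockZ, List.append_assoc]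

/-- A slice of `x` is the shifted slice of `0^{γ₃} x 0^{γ₃}`. [folklore] -/
theorem slice_eq_slice_ext {a l : ℕ} (X : List Bool) (h : a + l ≤ X.length) :
    slice a l X = slice (a + P.γ₃) l (zeros P.γ₃ ++ (X ++ zeros P.γ₃)) := by
  rw [← List.append_assoc, slice_append_left _ _ (by simp; omega),
    slice_append_right _ _ (by simp), length_zeros, Nat.add_sub_cancel]

section blocks

variable {n : ℕ} (x : Fin n → List Bool) (hx : ∀ i, (x i).length = P.ℓx)
include hx

/-- All listed blocks have length `ℓₓ`. [folklore] -/
theorem forall_mem_ofFn_length : ∀ z ∈ List.ofFn x, z.length = P.ℓx := by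
  intro z hz
  obtain ⟨i, rfl⟩ := (List.mem_ofFn' _ _).1 hz
  exact hx i

/-- `|x| + γ₃ = n · per` (`n ≥ 1`). [folklore] -/
theorem length_X_add (hn : 1 ≤ n) : (P.gadgetX (List.ofFn x)).length + P.γ₃ = n * P.per := by
  have hne : List.ofFn x ≠ [] := by simp [List.ofFn_eq_nil_iff]; omega
  rw [P.length_gadgetX_add hne (P.forall_mem_ofFn_length x hx), List.length_ofFn]

/-- Length of the prefix before block `i` in the first decomposition. [folklore] -/
theorem length_pre_blockZ (i : Fin n) :
    (zeros P.γ₃ ++ P.blocksZ ((List.ofFn x).take i)).length = P.γ₃ + i * P.per := by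
  rw [List.length_append, length_zeros, P.length_blocksZ fun z hz =>
    P.forall_mem_ofFn_length x hx z (List.mem_of_mem_take hz), List.length_take, List.length_ofFn,
    min_eq_left i.isLt.le]

/-- Length of the prefix before block `i` in the second decomposition. [folklore] -/
theorem length_pre_mid (i : Fin n) : (P.Zblocks ((List.ofFn x).take i)).length = i * P.per := by
  rw [P.length_Zblocks fun z hz => P.forall_mem_ofFn_length x hx z (List.mem_of_mem_take hz),
    List.length_take, List.length_ofFn, min_eq_left i.isLt.le]

/-- **A slice of `x` inside the neighbourhood `0^{γ₃} G(xᵢ) 0^{γ₃}` of block `i`** is the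
corresponding slice of `mid (x i)`. [folklore] -/
theorem slice_X_eq_slice_mid {a l : ℕ} (i : Fin n) (h1 : i * P.per ≤ a + P.γ₃)
    (h2 : a + l ≤ (i + 1) * P.per) (h3 : a + l ≤ (P.gadgetX (List.ofFn x)).length) :
    slice a l (P.gadgetX (List.ofFn x)) = slice (a + P.γ₃ - i * P.per) l (P.mid (x i)) := by
  have e : ((i : ℕ) + 1) * P.per = i * P.per + P.per := by ring
  rw [P.slice_eq_slice_ext _ h3, P.ext_eq_mid x i, slice_append_mid _ _ _
    (by rw [P.length_pre_mid x hx]; exact h1)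
    (by rw [P.length_pre_mid x hx, P.length_mid (hx i)]; omega),
    P.length_pre_mid x hx]

/-- **A slice of `x` inside the period `G(xᵢ) 0^{γ₃}` of block `i`** is the corresponding slice
of `blockZ (x i)`. [folklore] -/
theorem slice_X_eq_slice_blockZ {a l : ℕ} (i : Fin n) (h1 : i * P.per ≤ a)
    (h2 : a + l ≤ (i + 1) * P.per) (h3 : a + l ≤ (P.gadgetX (List.ofFn x)).length) :
    slice a l (P.gadgetX (List.ofFn x)) = slice (a - i * P.per) l (P.blockZ (x i)) := by
  have e : ((i : ℕ) + 1) * P.per = i * P.per + P.per := by ring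
  rw [P.slice_eq_slice_ext _ h3, P.ext_eq_blockZ x i, slice_append_mid _ _ _
    (by rw [P.length_pre_blockZ x hx]; omega)
    (by rw [P.length_pre_blockZ x hx, P.length_blockZ (hx i)]; omega),
    P.length_pre_blockZ x hx]
  congr 1; omega

end blocks


/-! #### Prefix balance (BK15 Claim 4.6) -/

section balance

/-- **Prefixes of a block are balanced up to `γ₃`**: every prefix of `G(z) 0^{γ₃}` (type
`(ℓₓ, sₓ)`) has at least as many ones as zeros, and at most `γ₃` more (BK15, proof of Claim 4.6:
"any prefix of `G(xᵢ) 0^{γ₃}` contains at least as many ones as zeroes").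
[cite: BringmannKunnemannFOCS2015, Claim 4.6 (proof)] -/
theorem count_take_blockZ {z : List Bool} (hz : z.length = P.ℓx) (hs : z.count true = P.sx)
    (r : ℕ) :
    ((P.blockZ z).take r).count false ≤ ((P.blockZ z).take r).count true ∧
      ((P.blockZ z).take r).count true ≤ ((P.blockZ z).take r).count false + P.γ₃ := by
  have hsl : P.sx ≤ P.ℓx := by rw [← hs, ← hz]; exact List.count_le_length
  have key : ∀ s : ℕ, (z.take s).count true ≤ P.sx ∧
      (z.take s).count true + (z.take s).count false = min s P.ℓx ∧
      (P.ℓx ≤ s → (z.take s).count true = P.sx) := fun s =>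
    ⟨hs ▸ count_take_le true _ z, by rw [← length_eq_count_add_count, List.length_take, hz],
      fun h => by rw [List.take_of_length_le (by omega), hs]⟩
  obtain ⟨k1, k2, k3⟩ := key (r - P.γ₂ - P.γ₁)
  simp only [blockZ, guard, count_take_append, length_ones, length_zeros, List.length_append, hz,
    count_true_take_ones, count_false_take_ones, count_true_take_zeros, count_false_take_zeros]
  simp only [γ₁, γ₂, γ₃] at *
  omega

/-- Prefixes of `blocksZ zs` are balanced up to `γ₃` (blocks of type `(ℓₓ, sₓ)`).
[cite: BringmannKunnemannFOCS2015, Claim 4.6 (proof)] -/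
theorem count_take_blocksZ {zs : List (List Bool)} (h : ∀ z ∈ zs, z.length = P.ℓx)
    (hs : ∀ z ∈ zs, z.count true = P.sx) (t : ℕ) :
    ((P.blocksZ zs).take t).count false ≤ ((P.blocksZ zs).take t).count true ∧
      ((P.blocksZ zs).take t).count true ≤ ((P.blocksZ zs).take t).count false + P.γ₃ := by
  induction zs generalizing t with
  | nil => simp [blocksZ]
  | cons z zs ih =>
      have hz := h z (by simp)
      have hzs := hs z (by simp)
      have ih' := ih (fun w hw => h w (by simp [hw])) (fun w hw => hs w (by simp [hw])) (t - P.per)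
      have hb := P.count_take_blockZ hz hzs t
      have hfull := P.count_blockZ hz hzs
      have hlen := P.length_blockZ hz
      simp only [blocksZ, List.map_cons, List.flatten_cons] at ih' ⊢
      rw [count_take_append, count_take_append, hlen]
      rcases le_or_gt t P.per with ht | ht
      · have : t - P.per = 0 := by omega
        rw [this]; simpa using hb
      · rw [List.take_of_length_le (by omega)] 
        omega

variable {n : ℕ} (x : Fin n → List Bool) (hx : ∀ i, (x i).length = P.ℓx)
  (hsx : ∀ i, (x i).count true = P.sx)
include hx hsx

omit hx in
/-- All listed blocks have `sₓ` ones. [folklore] -/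
theorem forall_mem_ofFn_count : ∀ z ∈ List.ofFn x, z.count true = P.sx := by
  intro z hz
  obtain ⟨i, rfl⟩ := (List.mem_ofFn' _ _).1 hz
  exact hsx i

/-- **BK15 Claim 4.6 for prefixes**: every prefix of `x` has at least as many ones as zeros, and
at most `γ₃` more. [cite: BringmannKunnemannFOCS2015, Claim 4.6] -/
theorem count_take_X (hn : 1 ≤ n) (t : ℕ) :
    ((P.gadgetX (List.ofFn x)).take t).count false ≤ ((P.gadgetX (List.ofFn x)).take t).count true ∧
      ((P.gadgetX (List.ofFn x)).take t).count true ≤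
        ((P.gadgetX (List.ofFn x)).take t).count false + P.γ₃ := by
  have hne : List.ofFn x ≠ [] := by simp [List.ofFn_eq_nil_iff]; omega
  set X := P.gadgetX (List.ofFn x)
  have h := P.count_take_blocksZ (P.forall_mem_ofFn_length x hx) (P.forall_mem_ofFn_count x hsx)
    (min t X.length)
  have e : X.take (min t X.length) = X.take t := by rw [← List.take_take, List.take_length]
  rw [← P.gadgetX_append_zeros hne, List.take_append_of_le_length (min_le_right _ _), e] at h
  exact h

/-- **Totals**: `x` has `n(2γ₂ + sₓ)` ones and `n(2γ₂ + sₓ) - γ₃` zeros. [folklore] -/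
theorem count_X (hn : 1 ≤ n) :
    (P.gadgetX (List.ofFn x)).count true = n * (2 * P.γ₂ + P.sx) ∧
      (P.gadgetX (List.ofFn x)).count false + P.γ₃ = n * (2 * P.γ₂ + P.sx) := by
  have hne : List.ofFn x ≠ [] := by simp [List.ofFn_eq_nil_iff]; omega
  obtain ⟨h1, h2⟩ := P.count_blocksZ (P.forall_mem_ofFn_length x hx) (P.forall_mem_ofFn_count x hsx)
  rw [← P.gadgetX_append_zeros hne, List.count_append, List.length_ofFn] at h1 h2
  rw [count_true_zeros, Nat.add_zero] at h1
  rw [count_false_zeros] at h2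
  exact ⟨h1, h2⟩

/-- **BK15 Claim 4.6 for suffixes**: every suffix of `x` has at least as many ones as zeros
("symmetric statements hold for any suffix of `x`"). [cite: BringmannKunnemannFOCS2015, Claim 4.6] -/
theorem count_drop_X (hn : 1 ≤ n) (t : ℕ) :
    ((P.gadgetX (List.ofFn x)).drop t).count false ≤ ((P.gadgetX (List.ofFn x)).drop t).count true := by
  have h1 := P.count_take_X x hx hsx hn t
  have h2 := P.count_X x hx hsx hn
  have e : ∀ b, ((P.gadgetX (List.ofFn x)).take t).count b +
      ((P.gadgetX (List.ofFn x)).drop t).count b = (P.gadgetX (List.ofFn x)).count b := fun b => by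
    rw [← List.count_append, List.take_append_drop]
  have e1 := e true
  have e2 := e false
  omega

/-- **BK15 Claim 4.6**: `δ(x', 0^N) ≥ N` for every prefix `x'` of `x`.
[cite: BringmannKunnemannFOCS2015, Claim 4.6] -/
theorem le_dLCS_take_zeros (hn : 1 ≤ n) (t N : ℕ) :
    N ≤ dLCS ((P.gadgetX (List.ofFn x)).take t) (zeros N) := by
  have h := (P.count_take_X x hx hsx hn t).1
  have hl := length_eq_count_add_count ((P.gadgetX (List.ofFn x)).take t)
  rw [zeros, dLCS_replicate_right]
  have := min_le_left (((P.gadgetX (List.ofFn x)).take t).count false) N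
  omega

/-- BK15 Claim 4.6, suffix form: `δ(x', 0^N) ≥ N` for every suffix `x'` of `x`.
[cite: BringmannKunnemannFOCS2015, Claim 4.6] -/
theorem le_dLCS_drop_zeros (hn : 1 ≤ n) (t N : ℕ) :
    N ≤ dLCS ((P.gadgetX (List.ofFn x)).drop t) (zeros N) := by
  have h := P.count_drop_X x hx hsx hn t
  have hl := length_eq_count_add_count ((P.gadgetX (List.ofFn x)).drop t)
  rw [zeros, dLCS_replicate_right]
  have := min_le_left (((P.gadgetX (List.ofFn x)).drop t).count false) N
  omega

end balance

/-! #### The upper bound of Lemma 4.3 (structured alignments) -/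

section upper

/-- Matching the guards: `|LCS(G(z), G(w))| = 2γ₂ + 2γ₁ + |LCS(z, w)|` (BK15, proof of
Lemma 4.3: "by matching the guarding ones and zeroes … `δ(G(x_{Δ+j}), G(yⱼ)) ≤ δ(x_{Δ+j}, yⱼ)`").
[cite: BringmannKunnemannFOCS2015, Lemma 4.3 (proof, upper bound)] -/
theorem lcsLength_guard_guard (z w : List Bool) :
    lcsLength (P.guard z) (P.guard w) = 2 * P.γ₂ + 2 * P.γ₁ + lcsLength z w := by
  simp only [guard]
  rw [lcsLength_append_same_left, lcsLength_append_same_left, lcsLength_append_same_right]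
  simp only [length_ones, length_zeros, List.length_append]
  ring

/-- The middle part of the structured upper bound: aligning `G(b_j)` with `G(w_j)` blockwise,
`|x'| + |y'| ≤ 2|LCS(x', y')| + ∑ⱼ δ(bⱼ, wⱼ)` for `x' = gadgetX (b)`, `y' = gadgetX (w)` with the
same number of blocks. [cite: BringmannKunnemannFOCS2015, Lemma 4.3 (proof, upper bound)] -/
theorem length_add_le_middle (k : ℕ) (b w : Fin (k + 1) → List Bool)
    (hb : ∀ j, (b j).length = P.ℓx) (hw : ∀ j, (w j).length = P.ℓy) :
    (P.gadgetX (List.ofFn b)).length + (P.gadgetX (List.ofFn w)).length ≤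
      2 * lcsLength (P.gadgetX (List.ofFn b)) (P.gadgetX (List.ofFn w)) + ∑ j, dLCS (b j) (w j) := by
  induction k with
  | zero =>
      have h1 := P.lcsLength_guard_guard (b 0) (w 0)
      have h2 := dLCS_add (b 0) (w 0)
      have hb0 := hb 0
      have hw0 := hw 0
      rw [Fin.sum_univ_succ, Fin.sum_univ_zero]
      simp only [List.ofFn_succ, List.ofFn_zero, gadgetX]
      rw [P.length_guard, P.length_guard, h1]
      omega
  | succ k ih =>
      have ih' := ih (fun j => b j.succ) (fun j => w j.succ) (fun j => hb _) (fun j => hw _)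
      have hne₁ : List.ofFn (fun j : Fin (k + 1) => b j.succ) ≠ [] := by simp
      have hne₂ : List.ofFn (fun j : Fin (k + 1) => w j.succ) ≠ [] := by simp
      rw [List.ofFn_succ, List.ofFn_succ (f := w), P.gadgetX_cons hne₁, P.gadgetX_cons hne₂]
      have h1 := P.lcsLength_guard_guard (b 0) (w 0)
      have h2 := lcsLength_append_append_le (P.guard (b 0))
        (zeros P.γ₃ ++ P.gadgetX (List.ofFn fun j : Fin (k + 1) => b j.succ)) (P.guard (w 0))
        (zeros P.γ₃ ++ P.gadgetX (List.ofFn fun j : Fin (k + 1) => w j.succ))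
      rw [lcsLength_append_same_left] at h2
      have h3 := dLCS_add (b 0) (w 0)
      have hb0 := hb 0
      have hw0 := hw 0
      rw [Fin.sum_univ_succ]
      simp only [List.length_append, P.length_guard, length_zeros] at ih' h2 ⊢
      omega

variable {n : ℕ} (x : Fin n → List Bool) (hx : ∀ i, (x i).length = P.ℓx)
  (hsx : ∀ i, (x i).count true = P.sx)
include hx hsx

/-- **BK15 Lemma 4.3, upper bound**: for every structured alignment `{(Δ+1,1),…,(Δ+m,m)}`,
`δ(x, y) ≤ C + ∑ⱼ δ(x_{Δ+j}, yⱼ)`. [cite: BringmannKunnemannFOCS2015, Lemma 4.3 (upper bound)] -/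
theorem dLCS_gadget_le_structuredCost {m : ℕ} (hm : 1 ≤ m) (y : Fin m → List Bool)
    (hy : ∀ j, (y j).length = P.ℓy) (Δ : ℕ) (hΔ : Δ + m ≤ n) :
    dLCS (P.gadgetX (List.ofFn x)) (P.gadgetY n (List.ofFn y)) ≤ P.C n + structuredCostL x y Δ hΔ := by
  obtain ⟨k, rfl⟩ : ∃ k, m = k + 1 := ⟨m - 1, by omega⟩
  have hn : 1 ≤ n := by omega
  have hsl : P.sx ≤ P.ℓx := by rw [← hsx ⟨0, hn⟩, ← hx ⟨0, hn⟩]; exact List.count_le_length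
  -- the three groups of blocks
  set xs := List.ofFn x with hxs
  have hb_eq0 : List.ofFn (fun j : Fin (k + 1) => x ⟨Δ + j, by omega⟩) = (xs.drop Δ).take (k + 1) := by
    apply List.ext_getElem (by simp [hxs]; omega)
    intro i h1 h2
    rw [List.getElem_ofFn]
    simp only [hxs, List.getElem_take, List.getElem_drop, List.getElem_ofFn]
  obtain ⟨bs, hbs⟩ : ∃ bs, bs = List.ofFn (fun j : Fin (k + 1) => x ⟨Δ + j, by omega⟩) := ⟨_, rfl⟩
  have hbne : bs ≠ [] := by rw [hbs]; simp
  have hb_eq : bs = (xs.drop Δ).take (k + 1) := by rw [hbs]; exact hb_eq0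
  have hsplit : xs = xs.take Δ ++ (bs ++ (xs.drop Δ).drop (k + 1)) := by
    rw [hb_eq, List.take_append_drop, List.take_append_drop]
  have hX : P.gadgetX xs = P.blocksZ (xs.take Δ) ++ (P.gadgetX bs ++ P.Zblocks ((xs.drop Δ).drop (k + 1))) := by
    conv_lhs => rw [hsplit]
    rw [P.gadgetX_append_left _ (by simp [hbne]), P.gadgetX_append_right hbne]
  -- lengths and counts of the outer groups
  have hlen_as : ∀ z ∈ xs.take Δ, z.length = P.ℓx := fun z hz =>
    P.forall_mem_ofFn_length x hx z (List.mem_of_mem_take hz)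
  have hcnt_as : ∀ z ∈ xs.take Δ, z.count true = P.sx := fun z hz =>
    P.forall_mem_ofFn_count x hsx z (List.mem_of_mem_take hz)
  have hlen_cs : ∀ z ∈ (xs.drop Δ).drop (k + 1), z.length = P.ℓx := fun z hz =>
    P.forall_mem_ofFn_length x hx z (List.mem_of_mem_drop (List.mem_of_mem_drop hz))
  have hcnt_cs : ∀ z ∈ (xs.drop Δ).drop (k + 1), z.count true = P.sx := fun z hz =>
    P.forall_mem_ofFn_count x hsx z (List.mem_of_mem_drop (List.mem_of_mem_drop hz))
  have L1 := P.length_blocksZ hlen_as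
  have L3 := P.length_Zblocks hlen_cs
  obtain ⟨-, C1⟩ := P.count_blocksZ hlen_as hcnt_as
  obtain ⟨-, C3⟩ := P.count_Zblocks hlen_cs hcnt_cs
  have hΔ' : (xs.take Δ).length = Δ := by simp [hxs]; omega
  have hcs' : ((xs.drop Δ).drop (k + 1)).length = n - Δ - (k + 1) := by simp [hxs]; omega
  rw [hΔ'] at L1 C1
  rw [hcs'] at L3 C3
  -- the LCS is at least the blockwise matching
  have l1 := lcsLength_append_append_le (P.blocksZ (xs.take Δ))
    (P.gadgetX bs ++ P.Zblocks ((xs.drop Δ).drop (k + 1))) (zeros (n * P.γ₄))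
    (P.gadgetX (List.ofFn y) ++ zeros (n * P.γ₄))
  have l2 := lcsLength_append_append_le (P.gadgetX bs) (P.Zblocks ((xs.drop Δ).drop (k + 1)))
    (P.gadgetX (List.ofFn y)) (zeros (n * P.γ₄))
  have l3 : lcsLength (P.blocksZ (xs.take Δ)) (zeros (n * P.γ₄)) = Δ * (2 * P.γ₂ + P.sx) := by
    rw [zeros, lcsLength_replicate_right, C1, min_eq_left]
    have : 2 * P.γ₂ + P.sx ≤ P.γ₄ := by simp only [γ₂, γ₄]; omega
    calc Δ * (2 * P.γ₂ + P.sx) ≤ n * (2 * P.γ₂ + P.sx) := Nat.mul_le_mul_right _ (by omega)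
      _ ≤ n * P.γ₄ := Nat.mul_le_mul_left _ this
  have l4 : lcsLength (P.Zblocks ((xs.drop Δ).drop (k + 1))) (zeros (n * P.γ₄)) =
      (n - Δ - (k + 1)) * (2 * P.γ₂ + P.sx) := by
    rw [zeros, lcsLength_replicate_right, C3, min_eq_left]
    have : 2 * P.γ₂ + P.sx ≤ P.γ₄ := by simp only [γ₂, γ₄]; omega
    calc (n - Δ - (k + 1)) * (2 * P.γ₂ + P.sx) ≤ n * (2 * P.γ₂ + P.sx) :=
        Nat.mul_le_mul_right _ (by omega)
      _ ≤ n * P.γ₄ := Nat.mul_le_mul_left _ this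
  have l5 := P.length_add_le_middle k (fun j : Fin (k + 1) => x ⟨Δ + j, by omega⟩) y (fun j => hx _) hy
  rw [← hbs] at l5
  have hper : P.per = 2 * (2 * P.γ₂ + P.sx) := by simp only [per, γ₁, γ₂, γ₃]; omega
  have hL1 : (P.blocksZ (xs.take Δ)).length = Δ * (2 * (2 * P.γ₂ + P.sx)) := by rw [L1, hper]
  have hL3 : (P.Zblocks ((xs.drop Δ).drop (k + 1))).length = (n - Δ - (k + 1)) * (2 * (2 * P.γ₂ + P.sx)) := by
    rw [L3, hper]
  -- assemble
  have key := dLCS_add (P.gadgetX xs) (P.gadgetY n (List.ofFn y))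
  rw [hX] at key ⊢
  simp only [gadgetY, List.length_append, length_zeros] at key l1 l2 ⊢
  unfold structuredCostL C
  have e1 : Δ * (2 * (2 * P.γ₂ + P.sx)) = 2 * (Δ * (2 * P.γ₂ + P.sx)) := by ring
  have e3 : (n - Δ - (k + 1)) * (2 * (2 * P.γ₂ + P.sx)) = 2 * ((n - Δ - (k + 1)) * (2 * P.γ₂ + P.sx)) := by
    ring
  omega

end upper

/-! #### Regions of `x` (for Claims 4.7 and 4.8) -/

section regions

/-- The head `1^{γ₂} 0^{γ₁} z` of a period. [folklore] -/
theorem take_blockZ_head {z : List Bool} (hz : z.length = P.ℓx) :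
    (P.blockZ z).take (P.γ₂ + P.γ₁ + P.ℓx) = ones P.γ₂ ++ (zeros P.γ₁ ++ z) := by
  have e : P.blockZ z = (ones P.γ₂ ++ (zeros P.γ₁ ++ z)) ++ (zeros P.γ₁ ++ (ones P.γ₂ ++ zeros P.γ₃)) := by
    simp [blockZ, guard, List.append_assoc]
  rw [e, List.take_left' (by simp [hz]; ring)]

/-- The head `0^{γ₃} 1^{γ₂} 0^{γ₁} z` of a neighbourhood. [folklore] -/
theorem take_mid_head {z : List Bool} (hz : z.length = P.ℓx) :
    (P.mid z).take (P.γ₃ + P.γ₂ + P.γ₁ + P.ℓx) = zeros P.γ₃ ++ (ones P.γ₂ ++ (zeros P.γ₁ ++ z)) := by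
  have e : P.mid z = (zeros P.γ₃ ++ (ones P.γ₂ ++ (zeros P.γ₁ ++ z))) ++
      (zeros P.γ₁ ++ (ones P.γ₂ ++ zeros P.γ₃)) := by
    simp [mid, guard, List.append_assoc]
  rw [e, List.take_left' (by simp [hz]; ring)]

/-- The tail `z 0^{γ₁} 1^{γ₂} 0^{γ₃}` of a period. [folklore] -/
theorem drop_blockZ (z : List Bool) :
    (P.blockZ z).drop (P.γ₂ + P.γ₁) = z ++ (zeros P.γ₁ ++ (ones P.γ₂ ++ zeros P.γ₃)) := by
  have e : P.blockZ z = (ones P.γ₂ ++ zeros P.γ₁) ++ (z ++ (zeros P.γ₁ ++ (ones P.γ₂ ++ zeros P.γ₃))) := by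
    simp [blockZ, guard, List.append_assoc]
  rw [e, List.drop_left' (by simp)]

/-- The zero block `0^{γ₃}` at the end of a period. [folklore] -/
theorem slice_blockZ_tail (z : List Bool) :
    slice (2 * P.γ₂ + 2 * P.γ₁ + z.length) P.γ₃ (P.blockZ z) = zeros P.γ₃ := by
  rw [blockZ, slice_append_right _ _ (by rw [P.length_guard]), P.length_guard, Nat.sub_self,
    slice_zero, List.take_of_length_le (by simp)]

/-- The piece facing a guard in Case B of Claim 4.7: a slice of `0^{γ₃} G(z) 0^{γ₃}` containing
`z` is `0^{h_L} 1^{r_L} 0^{q} z 0^{q'} 1^{r_R} 0^{h_R}` with `r_L, r_R ≤ γ₂`, `q, q' ≤ γ₁`, and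
`q < γ₁ ⇒ r_L = h_L = 0`, `q' < γ₁ ⇒ r_R = h_R = 0`. [cite: BringmannKunnemannFOCS2015, Claim 4.7 (proof)] -/
theorem slice_mid_shape {z : List Bool} (hz : z.length = P.ℓx) {a l : ℕ}
    (h1 : a ≤ P.γ₃ + P.γ₂ + P.γ₁) (h2 : P.γ₃ + P.γ₂ + P.γ₁ + P.ℓx ≤ a + l) :
    ∃ hL rL q q' rR hR : ℕ, rL ≤ P.γ₂ ∧ q ≤ P.γ₁ ∧ (q < P.γ₁ → rL = 0 ∧ hL = 0) ∧
      rR ≤ P.γ₂ ∧ q' ≤ P.γ₁ ∧ (q' < P.γ₁ → rR = 0 ∧ hR = 0) ∧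
      slice a l (P.mid z) =
        zeros hL ++ (ones rL ++ (zeros q ++ (z ++ (zeros q' ++ (ones rR ++ zeros hR))))) := by
  have e : P.mid z = (zeros P.γ₃ ++ (ones P.γ₂ ++ zeros P.γ₁)) ++ z ++
      (zeros P.γ₁ ++ (ones P.γ₂ ++ zeros P.γ₃)) := by
    simp [mid, guard, List.append_assoc]
  refine ⟨P.γ₃ - a, P.γ₂ - (a - P.γ₃), P.γ₁ - (a - P.γ₃ - P.γ₂),
    min (a + l - (P.γ₃ + (P.γ₂ + P.γ₁)) - P.ℓx) P.γ₁,
    min (a + l - (P.γ₃ + (P.γ₂ + P.γ₁)) - P.ℓx - P.γ₁) P.γ₂,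
    min (a + l - (P.γ₃ + (P.γ₂ + P.γ₁)) - P.ℓx - P.γ₁ - P.γ₂) P.γ₃,
    by omega, by omega, fun h => by omega, min_le_right _ _, min_le_right _ _, fun h => ?_, ?_⟩
  · have : a + l - (P.γ₃ + (P.γ₂ + P.γ₁)) - P.ℓx < P.γ₁ := by
      by_contra hc; exact absurd h (not_lt.2 (le_min (not_lt.1 hc) le_rfl))
    constructor <;> simp [this.le]
  rw [e, slice_append_covering _ _ _ (by simp; omega) (by simp [hz]; omega)]
  simp only [List.drop_append, List.take_append, zeros, ones, List.drop_replicate,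
    List.take_replicate, List.length_replicate, List.length_append, List.append_assoc, hz]

/-- A slice of `x` is a sublist (indeed a prefix) of the shifted slice of `0^{γ₃} x 0^{γ₃}`, without
any length hypothesis. [folklore] -/
theorem slice_X_sublist_slice_ext (s t : ℕ) (X : List Bool) :
    slice s t X <+ slice (s + P.γ₃) t (zeros P.γ₃ ++ (X ++ zeros P.γ₃)) := by
  rw [slice_append_right _ _ (by simp), length_zeros, Nat.add_sub_cancel]
  simp only [slice, List.drop_append, List.take_append]
  exact List.sublist_append_left _ _

variable {n : ℕ} (x : Fin n → List Bool) (hx : ∀ i, (x i).length = P.ℓx)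
include hx

/-- Slices of `0^{γ₃} x 0^{γ₃}` inside the period of block `i` (prefixed by `0^{γ₃}`). [folklore] -/
theorem slice_ext_blockZ (i : Fin n) {u L : ℕ} (h1 : P.γ₃ + i * P.per ≤ u)
    (h2 : u + L ≤ P.γ₃ + i * P.per + P.per) :
    slice u L (zeros P.γ₃ ++ (P.gadgetX (List.ofFn x) ++ zeros P.γ₃)) =
      slice (u - (P.γ₃ + i * P.per)) L (P.blockZ (x i)) := by
  rw [P.ext_eq_blockZ x i, slice_append_mid _ _ _ (by rw [P.length_pre_blockZ x hx]; exact h1)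
    (by rw [P.length_pre_blockZ x hx, P.length_blockZ (hx i)]; exact h2), P.length_pre_blockZ x hx]

end regions

/-! #### Claim 4.7: pieces that own a block -/

section claim47

/-- **The core of BK15 Claim 4.7**: for a piece `0^{h_L} 1^{r_L} 0^{q} xᵢ 0^{q'} 1^{r_R} 0^{h_R}`
as produced by `slice_mid_shape`, `δ(piece, G(yⱼ)) ≥ δ(xᵢ, yⱼ)` — strip the outer zeros against
the guarding ones of `G(yⱼ)` (Claim 4.5(2)), dispose of short pieces by length, and strip the
guards greedily (Claim 4.5(1), (2')). [cite: BringmannKunnemannFOCS2015, Claim 4.7] -/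
theorem dLCS_le_dLCS_padded (hℓ : P.ℓx ≤ P.ℓy) {xi w : List Bool} (hxi : xi.length = P.ℓx)
    (hw : w.length = P.ℓy) {hL rL q q' rR hR : ℕ} (hrL : rL ≤ P.γ₂) (hq : q ≤ P.γ₁)
    (hqi : q < P.γ₁ → rL = 0 ∧ hL = 0) (hrR : rR ≤ P.γ₂) (hq' : q' ≤ P.γ₁)
    (hq'i : q' < P.γ₁ → rR = 0 ∧ hR = 0) :
    dLCS xi w ≤ dLCS (zeros hL ++ (ones rL ++ (zeros q ++ (xi ++ (zeros q' ++ (ones rR ++ zeros hR))))))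
      (P.guard w) := by
  have d0 : dLCS xi w ≤ P.ℓx + P.ℓy := by
    have := dLCS_le_add xi w; rw [hxi, hw] at this; exact this
  have hγ₁ : P.ℓx + P.ℓy ≤ P.γ₁ := le_rfl
  have hγ₂ : P.ℓx + P.ℓy ≤ P.γ₂ := by simp only [γ₂]; omega
  have hft : false ≠ true := by decide
  -- the inner piece without the outer zeros
  obtain ⟨z, hz⟩ : ∃ z, z = ones rL ++ (zeros q ++ (xi ++ (zeros q' ++ ones rR))) := ⟨_, rfl⟩
  -- Step 1: the outer zeros on the left face `1^{γ₂}`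
  have s1 : min P.γ₂ (dLCS (z ++ zeros hR) (P.guard w)) ≤
      dLCS (zeros hL ++ (ones rL ++ (zeros q ++ (xi ++ (zeros q' ++ (ones rR ++ zeros hR))))))
        (P.guard w) := by
    have h := min_le_dLCS_replicate_append hft hL P.γ₂ (z ++ zeros hR)
      (zeros P.γ₁ ++ (w ++ (zeros P.γ₁ ++ ones P.γ₂)))
    simpa [hz, guard, ones, zeros, List.append_assoc] using h
  refine le_trans (le_min (d0.trans hγ₂) ?_) s1
  -- Step 2: the outer zeros on the right face the trailing `1^{γ₂}`
  have s2 : min P.γ₂ (dLCS z (P.guard w)) ≤ dLCS (z ++ zeros hR) (P.guard w) := by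
    have h := min_le_dLCS_append_replicate hft hR P.γ₂ z
      (ones P.γ₂ ++ (zeros P.γ₁ ++ (w ++ zeros P.γ₁)))
    simpa [guard, ones, zeros, List.append_assoc] using h
  refine le_trans (le_min (d0.trans hγ₂) ?_) s2
  -- Step 3: short pieces
  by_cases hlen : z.length + P.γ₂ ≤ (P.guard w).length
  · have := length_sub_length_le_dLCS' z (P.guard w)
    omega
  -- long pieces contain the full inner guarding `0^{γ₁} xi 0^{γ₁}`
  have hzlen : z.length = rL + q + P.ℓx + q' + rR := by
    simp only [hz, List.length_append, length_ones, length_zeros, hxi]; ring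
  rw [P.length_guard, hw] at hlen
  have hq1 : q = P.γ₁ := by
    by_contra hne
    obtain ⟨h1, -⟩ := hqi (lt_of_le_of_ne hq hne)
    simp only [γ₁, γ₂] at *; omega
  have hq2 : q' = P.γ₁ := by
    by_contra hne
    obtain ⟨h1, -⟩ := hq'i (lt_of_le_of_ne hq' hne)
    simp only [γ₁, γ₂] at *; omega
  subst hq1 hq2
  -- Step 3': strip the common leading `1^{r_L}`
  have e3 : P.guard w = ones rL ++ (ones (P.γ₂ - rL) ++ (zeros P.γ₁ ++ (w ++ (zeros P.γ₁ ++ ones P.γ₂)))) := by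
    rw [← List.append_assoc, ← ones_add, Nat.add_sub_cancel' hrL]; rfl
  rw [hz, e3, dLCS_append_same_left]
  -- Step 4: the leading `0^{γ₁}` faces `1^{γ₂ - r_L}`
  have s4 := min_le_dLCS_replicate_append' hft P.γ₁ (P.γ₂ - rL) (xi ++ (zeros P.γ₁ ++ ones rR))
    (zeros P.γ₁ ++ (w ++ (zeros P.γ₁ ++ ones P.γ₂)))
  rw [← ones, ← zeros] at s4
  refine le_trans (le_min (d0.trans hγ₁) ?_) s4
  -- Step 5: strip the common `0^{γ₁}`
  rw [dLCS_append_same_left]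
  -- Step 6: strip the common trailing `1^{r_R}`
  have e6 : w ++ (zeros P.γ₁ ++ ones P.γ₂) = (w ++ (zeros P.γ₁ ++ ones (P.γ₂ - rR))) ++ ones rR := by
    rw [List.append_assoc, List.append_assoc, ← ones_add, Nat.sub_add_cancel hrR]
  have e6' : xi ++ (zeros P.γ₁ ++ ones rR) = (xi ++ zeros P.γ₁) ++ ones rR := by
    rw [List.append_assoc]
  rw [e6, e6', dLCS_append_same_right]
  -- Step 7: the trailing `0^{γ₁}` faces `1^{γ₂ - r_R}`
  have s7 := min_le_dLCS_append_replicate' hft P.γ₁ (P.γ₂ - rR) xi (w ++ zeros P.γ₁)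
  rw [← ones, ← zeros, List.append_assoc] at s7
  refine le_trans (le_min (d0.trans hγ₁) ?_) s7
  -- Step 8: strip the common `0^{γ₁}`
  rw [dLCS_append_same_right]

variable {n : ℕ} (x : Fin n → List Bool) (hx : ∀ i, (x i).length = P.ℓx)
  (hsx : ∀ i, (x i).count true = P.sx)
include hx

/-- **BK15 Claim 4.7**: if the piece `x[s..s+t)` facing `G(yⱼ)` contains (all of) `xᵢ`, then
`δ(x[s..s+t), G(yⱼ)) ≥ δ(xᵢ, yⱼ)`. (Case A: the piece reaches another block, then it is long and
the length bound applies; Case B: it lies inside `0^{γ₃} G(xᵢ) 0^{γ₃}`, `dLCS_le_dLCS_padded`.)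
[cite: BringmannKunnemannFOCS2015, Claim 4.7] -/
theorem dLCS_le_dLCS_slice_guard (hℓ : P.ℓx ≤ P.ℓy) {s t : ℕ}
    (hst : s + t ≤ (P.gadgetX (List.ofFn x)).length) (i : Fin n)
    (hown : s ≤ P.cpos i ∧ P.cpos i + P.ℓx ≤ s + t) (w : List Bool) (hw : w.length = P.ℓy) :
    dLCS (x i) w ≤ dLCS (slice s t (P.gadgetX (List.ofFn x))) (P.guard w) := by
  have d0 : dLCS (x i) w ≤ P.ℓx + P.ℓy := by
    have := dLCS_le_add (x i) w; rw [hx, hw] at this; exact this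
  simp only [cpos] at hown
  by_cases hB : i * P.per ≤ s + P.γ₃ ∧ s + t ≤ (i + 1) * P.per
  · -- Case B
    rw [P.slice_X_eq_slice_mid x hx i hB.1 hB.2 hst]
    obtain ⟨hL, rL, q, q', rR, hR, hrL, hq, hqi, hrR, hq', hq'i, e⟩ :=
      P.slice_mid_shape (hx i) (a := s + P.γ₃ - i * P.per) (l := t) (by omega) (by omega)
    rw [e]
    exact P.dLCS_le_dLCS_padded hℓ (hx i) hw hrL hq hqi hrR hq' hq'i
  · -- Case A: the piece is long
    have e : ((i : ℕ) + 1) * P.per = i * P.per + P.per := by ring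
    have hg : 2 * P.γ₂ + 2 * P.γ₁ + P.ℓx + P.γ₃ = P.per := rfl
    have ht : P.γ₃ + P.γ₂ + P.γ₁ + P.ℓx ≤ t := by
      rw [not_and_or, not_le, not_le, e] at hB
      omega
    have h1 := length_sub_length_le_dLCS (slice s t (P.gadgetX (List.ofFn x))) (P.guard w)
    rw [length_slice hst, P.length_guard, hw] at h1
    simp only [γ₁, γ₂, γ₃] at *; omega

end claim47

/-! #### Claim 4.8: pieces that own no block -/

section claim48

variable {n : ℕ} (x : Fin n → List Bool) (hx : ∀ i, (x i).length = P.ℓx)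
  (hsx : ∀ i, (x i).count true = P.sx)
include hx hsx

/-- **The structure of `x` seen by an interval** (BK15, proof of Claim 4.8: "examining the
structure of `x`"): every piece `x[s..s+t)` either contains some `xᵢ` entirely, or has at most
`γ₂ + ℓₓ` ones, or at least `γ₃` zeros. [cite: BringmannKunnemannFOCS2015, Claim 4.8 (proof)] -/
theorem slice_cases (hn : 1 ≤ n) {s t : ℕ} (hst : s + t ≤ (P.gadgetX (List.ofFn x)).length) :
    (∃ i : Fin n, s ≤ P.cpos i ∧ P.cpos i + P.ℓx ≤ s + t) ∨
      (slice s t (P.gadgetX (List.ofFn x))).count true ≤ P.γ₂ + P.ℓx ∨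
      P.γ₃ ≤ (slice s t (P.gadgetX (List.ofFn x))).count false := by
  have hsl : P.sx ≤ P.ℓx := by rw [← hsx ⟨0, hn⟩, ← hx ⟨0, hn⟩]; exact List.count_le_length
  have hlenX := P.length_X_add x hx hn
  rcases Nat.eq_zero_or_pos t with rfl | ht
  · right; left; simp [slice]
  have hs : s < (P.gadgetX (List.ofFn x)).length := by omega
  have hper0 : 0 < P.per := Nat.pos_of_ne_zero fun h => by rw [h] at hlenX; omega
  have hg : 2 * P.γ₂ + 2 * P.γ₁ + P.ℓx + P.γ₃ = P.per := rfl
  -- the block of position `s`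
  have hin : s / P.per < n := (Nat.div_lt_iff_lt_mul hper0).2 (by omega)
  obtain ⟨I, hI⟩ : ∃ I : Fin n, (I : ℕ) = s / P.per := ⟨⟨_, hin⟩, rfl⟩
  obtain ⟨r, hr⟩ : ∃ r, r = s % P.per := ⟨_, rfl⟩
  have hsr : s = I * P.per + r := by
    rw [hI, hr, Nat.mul_comm]; exact (Nat.div_add_mod s P.per).symm
  have hrlt : r < P.per := hr ▸ Nat.mod_lt _ hper0
  have hIlt := I.isLt
  have hI1 : ((I : ℕ) + 1) * P.per ≤ n * P.per := Nat.mul_le_mul_right _ hIlt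
  have e1 : ((I : ℕ) + 1) * P.per = I * P.per + P.per := by ring
  by_cases h1 : r ≤ P.γ₂ + P.γ₁
  · by_cases h2 : P.cpos I + P.ℓx ≤ s + t
    · exact Or.inl ⟨I, by simp only [cpos]; omega, h2⟩
    · right; left
      simp only [cpos] at h2
      have hsub : slice s t (P.gadgetX (List.ofFn x)) <+
          slice (I * P.per) (P.γ₂ + P.γ₁ + P.ℓx) (P.gadgetX (List.ofFn x)) :=
        slice_sublist_slice _ (by omega) (by omega)
      have hreg : slice (I * P.per) (P.γ₂ + P.γ₁ + P.ℓx) (P.gadgetX (List.ofFn x)) =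
          ones P.γ₂ ++ (zeros P.γ₁ ++ x I) := by
        rw [P.slice_X_eq_slice_blockZ x hx I le_rfl (by omega) (by omega), Nat.sub_self, slice_zero,
          P.take_blockZ_head (hx _)]
      have hc := hsub.count_le true
      rw [hreg] at hc
      simp only [List.count_append, count_true_ones, count_true_zeros, hsx] at hc
      omega
  · rw [not_le] at h1
    by_cases h3 : 2 * P.γ₂ + 2 * P.γ₁ + P.ℓx ≤ r
    · -- `s` lies in the zero block after `G(xᵢ)`; then block `i + 1` exists
      have hin' : (I : ℕ) + 1 < n := by
        by_contra hc
        have hn' : n = I + 1 := by omega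
        have : n * P.per = (I + 1) * P.per := congrArg (· * P.per) hn'
        omega
      obtain ⟨I', hI'⟩ : ∃ I' : Fin n, (I' : ℕ) = I + 1 := ⟨⟨_, hin'⟩, rfl⟩
      have hI'lt := I'.isLt
      have hI2 : ((I' : ℕ) + 1) * P.per ≤ n * P.per := Nat.mul_le_mul_right _ hI'lt
      have e2 : ((I' : ℕ) + 1) * P.per = I * P.per + P.per + P.per := by rw [hI']; ring
      have e2' : (I' : ℕ) * P.per = I * P.per + P.per := by rw [hI']; ring
      by_cases h4 : P.cpos I' + P.ℓx ≤ s + t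
      · exact Or.inl ⟨I', by simp only [cpos]; omega, h4⟩
      · right; left
        simp only [cpos] at h4
        have hsub : slice s t (P.gadgetX (List.ofFn x)) <+
            slice (I * P.per + (2 * P.γ₂ + 2 * P.γ₁ + P.ℓx)) (P.γ₃ + P.γ₂ + P.γ₁ + P.ℓx)
              (P.gadgetX (List.ofFn x)) :=
          slice_sublist_slice _ (by omega) (by omega)
        have hreg : slice (I * P.per + (2 * P.γ₂ + 2 * P.γ₁ + P.ℓx)) (P.γ₃ + P.γ₂ + P.γ₁ + P.ℓx)
            (P.gadgetX (List.ofFn x)) = zeros P.γ₃ ++ (ones P.γ₂ ++ (zeros P.γ₁ ++ x I')) := by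
          rw [P.slice_X_eq_slice_mid x hx I' (by omega) (by omega) (by omega)]
          have : (I : ℕ) * P.per + (2 * P.γ₂ + 2 * P.γ₁ + P.ℓx) + P.γ₃ - I' * P.per = 0 := by omega
          rw [this, slice_zero, P.take_mid_head (hx _)]
        have hc := hsub.count_le true
        rw [hreg] at hc
        simp only [List.count_append, count_true_ones, count_true_zeros, hsx] at hc
        omega
    · rw [not_le] at h3
      by_cases h5 : s + t ≤ ((I : ℕ) + 1) * P.per
      · -- a short piece after the start of `xᵢ`: at most `ℓₓ + γ₂` ones
        right; left
        have hsub₁ := P.slice_X_sublist_slice_ext s t (P.gadgetX (List.ofFn x))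
        have hsub₂ : slice (s + P.γ₃) t (zeros P.γ₃ ++ (P.gadgetX (List.ofFn x) ++ zeros P.γ₃)) <+
            slice (P.cpos I + P.γ₃) (P.ℓx + P.γ₁ + P.γ₂ + P.γ₃)
              (zeros P.γ₃ ++ (P.gadgetX (List.ofFn x) ++ zeros P.γ₃)) :=
          slice_sublist_slice _ (by simp only [cpos]; omega) (by simp only [cpos]; omega)
        have hreg : slice (P.cpos I + P.γ₃) (P.ℓx + P.γ₁ + P.γ₂ + P.γ₃)
            (zeros P.γ₃ ++ (P.gadgetX (List.ofFn x) ++ zeros P.γ₃)) =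
              x I ++ (zeros P.γ₁ ++ (ones P.γ₂ ++ zeros P.γ₃)) := by
          rw [P.slice_ext_blockZ x hx I (by simp only [cpos]; omega) (by simp only [cpos]; omega)]
          have : P.cpos I + P.γ₃ - (P.γ₃ + I * P.per) = P.γ₂ + P.γ₁ := by
            simp only [cpos]; omega
          rw [this, slice, P.drop_blockZ, List.take_of_length_le]
          simp only [List.length_append, length_zeros, length_ones, hx]; omega
        have hc := (hsub₁.trans hsub₂).count_le true
        rw [hreg] at hc
        simp only [List.count_append, count_true_ones, count_true_zeros, hsx] at hc
        omega
      · -- a piece reaching over the zero block after `G(xᵢ)`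
        right; right
        rw [not_le] at h5
        have hsub : slice (I * P.per + (2 * P.γ₂ + 2 * P.γ₁ + P.ℓx)) P.γ₃ (P.gadgetX (List.ofFn x)) <+
            slice s t (P.gadgetX (List.ofFn x)) :=
          slice_sublist_slice _ (by omega) (by omega)
        have hreg : slice (I * P.per + (2 * P.γ₂ + 2 * P.γ₁ + P.ℓx)) P.γ₃ (P.gadgetX (List.ofFn x)) =
            zeros P.γ₃ := by
          rw [P.slice_X_eq_slice_blockZ x hx I (by omega) (by omega) (by omega), Nat.add_sub_cancel_left,
            ← hx I, P.slice_blockZ_tail]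
        have hc := hsub.count_le false
        rw [hreg, count_false_zeros] at hc
        exact hc

/-- **BK15 Claim 4.8**: if the piece `x[s..s+t)` facing `G(yⱼ)` contains no `xᵢ` entirely, then
`δ(x[s..s+t), G(yⱼ)) ≥ ℓₓ + ℓ_y` (counting ones, resp. zeros).
[cite: BringmannKunnemannFOCS2015, Claim 4.8] -/
theorem add_le_dLCS_slice_guard (hn : 1 ≤ n) {s t : ℕ}
    (hst : s + t ≤ (P.gadgetX (List.ofFn x)).length)
    (hno : ∀ i : Fin n, ¬ (s ≤ P.cpos i ∧ P.cpos i + P.ℓx ≤ s + t)) (w : List Bool)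
    (hw : w.length = P.ℓy) :
    P.ℓx + P.ℓy ≤ dLCS (slice s t (P.gadgetX (List.ofFn x))) (P.guard w) := by
  have hsl : P.sx ≤ P.ℓx := by rw [← hsx ⟨0, hn⟩, ← hx ⟨0, hn⟩]; exact List.count_le_length
  rcases P.slice_cases x hx hsx hn hst with ⟨i, hi⟩ | hct | hcf
  · exact absurd hi (hno i)
  · have h := count_sub_count_le_dLCS' (slice s t (P.gadgetX (List.ofFn x))) (P.guard w) true
    rw [P.count_true_guard] at h
    simp only [γ₂] at *; omega
  · have h := count_sub_count_le_dLCS (slice s t (P.gadgetX (List.ofFn x))) (P.guard w) false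
    rw [P.count_false_guard] at h
    have : w.count false ≤ P.ℓy := hw ▸ List.count_le_length
    simp only [γ₁, γ₃] at *; omega

end claim48

/-! #### Splitting a piece along the blocks of the core of `y` (Claim 4.4) -/

section pieces

/-- Slicing a slice. [folklore] -/
theorem slice_slice {α : Type*} (a l s t : ℕ) (x : List α) (h : s + t ≤ l) :
    slice s t (slice a l x) = slice (a + s) t x := by
  simp only [slice, List.drop_take, List.take_take, List.drop_drop]
  congr 1; omega

/-- **BK15 Claim 4.4 along the core `G(w₀) 0^{γ₃} ⋯ G(w_k)`**: every string `S` splits into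
consecutive pieces `S[st j .. st j + ln j)` facing the `G(wⱼ)` (the pieces facing the zero blocks
and their nonnegative costs are dropped) with `∑ⱼ δ(S[st j ..), G(wⱼ)) ≤ δ(S, core)`.
[cite: BringmannKunnemannFOCS2015, Claim 4.4 (with the lower-bound part of the proof of Lemma 4.3)] -/
theorem exists_pieces : ∀ (k : ℕ) (w : Fin (k + 1) → List Bool) (S : List Bool),
    ∃ st ln : Fin (k + 1) → ℕ,
      (∀ j j' : Fin (k + 1), j < j' → st j + ln j ≤ st j') ∧
      st (Fin.last k) + ln (Fin.last k) ≤ S.length ∧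
      ∑ j, dLCS (slice (st j) (ln j) S) (P.guard (w j)) ≤ dLCS S (P.gadgetX (List.ofFn w))
  | 0, w, S => by
      refine ⟨fun _ => 0, fun _ => S.length, fun j j' h => ?_, by simp, ?_⟩
      · have := j'.isLt; have := Fin.lt_def.1 h; omega
      · rw [Fin.sum_univ_succ, Fin.sum_univ_zero, slice_zero_length]
        simp [gadgetX]
  | k + 1, w, S => by
      have hne : List.ofFn (fun j : Fin (k + 1) => w j.succ) ≠ [] := by simp
      obtain ⟨S₁, S₂₃, e₁, h₁⟩ := exists_split_lcsLength_append_right S (P.guard (w 0))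
        (zeros P.γ₃ ++ P.gadgetX (List.ofFn fun j : Fin (k + 1) => w j.succ))
      obtain ⟨S₂, S₃, e₂, h₂⟩ := exists_split_lcsLength_append_right S₂₃ (zeros P.γ₃)
        (P.gadgetX (List.ofFn fun j : Fin (k + 1) => w j.succ))
      obtain ⟨st', ln', hmono', hlast', hsum'⟩ := exists_pieces k (fun j => w j.succ) S₃
      refine ⟨Fin.cons 0 (fun j => S₁.length + S₂.length + st' j), Fin.cons S₁.length ln',
        ?_, ?_, ?_⟩
      · intro j j' hjj'
        cases j using Fin.cases with
        | zero =>
            cases j' using Fin.cases with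
            | zero => exact absurd hjj' (lt_irrefl _)
            | succ j' => simp only [Fin.cons_zero, Fin.cons_succ]; omega
        | succ j =>
            cases j' using Fin.cases with
            | zero => exact absurd (Fin.lt_def.1 hjj') (by simp)
            | succ j' =>
                simp only [Fin.cons_succ]
                have := hmono' j j' (Fin.succ_lt_succ_iff.1 hjj')
                omega
      · rw [← Fin.succ_last, Fin.cons_succ, Fin.cons_succ]
        have : S.length = S₁.length + S₂.length + S₃.length := by
          rw [← e₁, ← e₂]; simp only [List.length_append]; ring
        omega
      · rw [Fin.sum_univ_succ]
        simp only [Fin.cons_zero, Fin.cons_succ]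
        have hs0 : slice 0 S₁.length S = S₁ := by rw [← e₁, slice_zero, List.take_left]
        have hsj : ∀ j, slice (S₁.length + S₂.length + st' j) (ln' j) S = slice (st' j) (ln' j) S₃ :=
          fun j => by
          rw [← e₁, ← e₂, slice_append_right _ _ (by omega), slice_append_right _ _ (by omega)]
          congr 1; omega
        rw [hs0]
        simp only [hsj]
        rw [List.ofFn_succ, P.gadgetX_cons hne]
        have k0 := dLCS_add S (P.guard (w 0) ++
          (zeros P.γ₃ ++ P.gadgetX (List.ofFn fun j : Fin (k + 1) => w j.succ)))
        have k1 := dLCS_add S₁ (P.guard (w 0))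
        have k3 := dLCS_add S₃ (P.gadgetX (List.ofFn fun j : Fin (k + 1) => w j.succ))
        have k2 := two_mul_lcsLength_le S₂ (zeros P.γ₃)
        have hlen : S.length = S₁.length + S₂.length + S₃.length := by
          rw [← e₁, ← e₂]; simp only [List.length_append]; ring
        simp only [List.length_append, length_zeros] at k0 k2
        omega

end pieces

/-! #### The lower bound of Lemma 4.3 -/

section lower

/-- Bookkeeping for the cost of the alignment read off from the pieces: with
`A = [(i, j) | own j = some i]`, `∑_{(i,j) ∈ A} v i j + (m - |A|) u = ∑ⱼ (own j).elim u (v · j)`.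
[folklore] -/
theorem sum_filterMap_owner {m n : ℕ} (own : Fin m → Option (Fin n)) (v : Fin n → Fin m → ℕ)
    (u : ℕ) (js : List (Fin m)) :
    ((js.filterMap fun j => (own j).map fun i => (i, j)).map fun p => v p.1 p.2).sum +
        (js.length - (js.filterMap fun j => (own j).map fun i => (i, j)).length) * u =
      (js.map fun j => (own j).elim u fun i => v i j).sum ∧
    (js.filterMap fun j => (own j).map fun i => (i, j)).length ≤ js.length := by
  induction js with
  | nil => simp
  | cons j js ih =>
      obtain ⟨ih1, ih2⟩ := ih
      cases hj : own j with
      | none =>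
          simp only [List.filterMap_cons, hj, Option.map_none, List.map_cons, List.sum_cons,
            Option.elim_none, List.length_cons]
          refine ⟨?_, by omega⟩
          rw [Nat.succ_sub ih2, Nat.succ_mul]
          omega
      | some i =>
          simp only [List.filterMap_cons, hj, Option.map_some, List.map_cons, List.sum_cons,
            Option.elim_some, List.length_cons, Nat.add_sub_add_right]
          omega

variable {n : ℕ} (x : Fin n → List Bool) (hx : ∀ i, (x i).length = P.ℓx)
  (hsx : ∀ i, (x i).count true = P.sx)
include hx hsx

/-- **The pieces of a slice of `x` carry an alignment** (BK15, proof of Lemma 4.3, lower bound: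
"if `x(G(yⱼ))` contains … `xᵢ` … align `i` and `j` … in order to show (4) it suffices to prove
Claims 4.7 and 4.8"): for every slice `S = x[a..a+l)` there is an alignment `A` with
`δ(A) ≤ δ(S, G(y₁) 0^{γ₃} ⋯ G(y_m))`. [cite: BringmannKunnemannFOCS2015, Lemma 4.3 (proof, lower bound)] -/
theorem exists_alignment_le_dLCS_slice (hn : 1 ≤ n) (hℓx : 1 ≤ P.ℓx) (hℓ : P.ℓx ≤ P.ℓy) {m : ℕ}
    (hm : 1 ≤ m) (y : Fin m → List Bool) (hy : ∀ j, (y j).length = P.ℓy) {a l : ℕ}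
    (hal : a + l ≤ (P.gadgetX (List.ofFn x)).length) :
    ∃ A : List (Fin n × Fin m), IsAlignment A ∧
      alignCostL x y A ≤ dLCS (slice a l (P.gadgetX (List.ofFn x))) (P.gadgetX (List.ofFn y)) := by
  classical
  obtain ⟨k, rfl⟩ : ∃ k, m = k + 1 := ⟨m - 1, by omega⟩
  obtain ⟨st, ln, hmono, hlast, hsum⟩ := P.exists_pieces k y (slice a l (P.gadgetX (List.ofFn x)))
  rw [length_slice hal] at hlast
  have hin : ∀ j, st j + ln j ≤ l := fun j => by
    rcases (Fin.le_last j).lt_or_eq with hj | hj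
    · have := hmono j _ hj; omega
    · rw [hj]; exact hlast
  have hpiece : ∀ j, slice (st j) (ln j) (slice a l (P.gadgetX (List.ofFn x))) =
      slice (a + st j) (ln j) (P.gadgetX (List.ofFn x)) := fun j => slice_slice _ _ _ _ _ (hin j)
  simp only [hpiece] at hsum
  -- ownership of the pieces
  let own : Fin (k + 1) → Option (Fin n) := fun j =>
    if h : ∃ i : Fin n, a + st j ≤ P.cpos i ∧ P.cpos i + P.ℓx ≤ a + st j + ln j then
      some (Fin.find _ h) else none
  have spec : ∀ j i, own j = some i → a + st j ≤ P.cpos i ∧ P.cpos i + P.ℓx ≤ a + st j + ln j := by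
    intro j i h
    simp only [own] at h
    split_ifs at h with hex
    rw [Option.some.injEq] at h
    rw [← h]; exact Fin.find_spec hex
  have spec' : ∀ j, own j = none → ∀ i : Fin n, ¬ (a + st j ≤ P.cpos i ∧ P.cpos i + P.ℓx ≤ a + st j + ln j) := by
    intro j h i hi
    simp only [own] at h
    split_ifs at h with hex
    exact hex ⟨i, hi⟩
  refine ⟨(List.finRange (k + 1)).filterMap fun j => (own j).map fun i => (i, j), ?_, ?_⟩
  · -- it is an alignment: pieces are ordered, so are the blocks they contain
    refine (List.pairwise_lt_finRange (k + 1)).filterMap _ ?_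
    intro j j' hjj' p hp q hq
    rw [Option.map_eq_some_iff] at hp hq
    obtain ⟨i, hi, rfl⟩ := hp
    obtain ⟨i', hi', rfl⟩ := hq
    obtain ⟨h1, h2⟩ := spec j i hi
    obtain ⟨h1', h2'⟩ := spec j' i' hi'
    have hm := hmono j j' hjj'
    refine ⟨show i < i' from ?_, hjj'⟩
    have hc : P.cpos i < P.cpos i' := by omega
    simp only [cpos] at hc
    by_contra hii
    have := Nat.mul_le_mul_right P.per (Fin.not_lt.1 hii)
    omega
  · -- its cost
    obtain ⟨hs1, hs2⟩ := sum_filterMap_owner own (fun i j => dLCS (x i) (y j)) (P.ℓx + P.ℓy)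
      (List.finRange (k + 1))
    rw [List.length_finRange] at hs1 hs2
    have hmax : maxDistL x y ≤ P.ℓx + P.ℓy := maxDistL_le fun i j => by
      have := dLCS_le_add (x i) (y j); rw [hx, hy] at this; exact this
    have hj : ∀ j, (own j).elim (P.ℓx + P.ℓy) (fun i => dLCS (x i) (y j)) ≤
        dLCS (slice (a + st j) (ln j) (P.gadgetX (List.ofFn x))) (P.guard (y j)) := by
      intro j
      have hst : a + st j + ln j ≤ (P.gadgetX (List.ofFn x)).length := by have := hin j; omega
      cases h : own j with
      | some i =>
          simp only [Option.elim_some]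
          exact P.dLCS_le_dLCS_slice_guard x hx hℓ hst i (spec j i h) _ (hy j)
      | none =>
          simp only [Option.elim_none]
          exact P.add_le_dLCS_slice_guard x hx hsx hn hst (spec' j h) _ (hy j)
    have hsumj : ((List.finRange (k + 1)).map fun j =>
        (own j).elim (P.ℓx + P.ℓy) fun i => dLCS (x i) (y j)).sum ≤
          ∑ j, dLCS (slice (a + st j) (ln j) (P.gadgetX (List.ofFn x))) (P.guard (y j)) := by
      rw [← Fin.sum_univ_def]
      exact Finset.sum_le_sum fun j _ => hj j
    unfold alignCostL
    calc _ ≤ (((List.finRange (k + 1)).filterMap fun j => (own j).map fun i => (i, j)).map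
            fun p => dLCS (x p.1) (y p.2)).sum +
          (k + 1 - ((List.finRange (k + 1)).filterMap fun j => (own j).map fun i => (i, j)).length) *
            (P.ℓx + P.ℓy) := Nat.add_le_add_left (Nat.mul_le_mul_left _ hmax) _
      _ = _ := hs1
      _ ≤ _ := hsumj
      _ ≤ _ := hsum

/-- **BK15 Lemma 4.3, lower bound**: some alignment `A` has `C + δ(A) ≤ δ(x, y)` — split `x`
along `0^{nγ₄} | core | 0^{nγ₄}` (Claim 4.4), bound the outer pieces by Claim 4.6 and read the
alignment off the middle piece. [cite: BringmannKunnemannFOCS2015, Lemma 4.3 (lower bound)] -/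
theorem exists_alignment_le_dLCS_gadget (hℓx : 1 ≤ P.ℓx) (hℓ : P.ℓx ≤ P.ℓy) {m : ℕ} (hm : 1 ≤ m)
    (hmn : m ≤ n) (y : Fin m → List Bool) (hy : ∀ j, (y j).length = P.ℓy) :
    ∃ A : List (Fin n × Fin m), IsAlignment A ∧
      P.C n + alignCostL x y A ≤ dLCS (P.gadgetX (List.ofFn x)) (P.gadgetY n (List.ofFn y)) := by
  have hn : 1 ≤ n := hm.trans hmn
  obtain ⟨X, hX⟩ : ∃ X, X = P.gadgetX (List.ofFn x) := ⟨_, rfl⟩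
  obtain ⟨x₁, x₂₃, e₁, h₁⟩ := exists_split_lcsLength_append_right X (zeros (n * P.γ₄))
    (P.gadgetX (List.ofFn y) ++ zeros (n * P.γ₄))
  obtain ⟨x₂, x₃, e₂, h₂⟩ := exists_split_lcsLength_append_right x₂₃ (P.gadgetX (List.ofFn y))
    (zeros (n * P.γ₄))
  have hx₁ : x₁ = X.take x₁.length := by rw [← e₁, List.take_left]
  have hx₃ : x₃ = X.drop (x₁.length + x₂.length) := by
    rw [← e₁, ← e₂, ← List.drop_drop, List.drop_left, List.drop_left]
  have hx₂ : x₂ = slice x₁.length x₂.length X := by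
    rw [← e₁, ← e₂, slice_append_right _ _ le_rfl, Nat.sub_self, slice_zero, List.take_left]
  have hlen : X.length = x₁.length + x₂.length + x₃.length := by
    rw [← e₁, ← e₂]; simp only [List.length_append]; ring
  have b₁ := P.le_dLCS_take_zeros x hx hsx hn x₁.length (n * P.γ₄)
  have b₃ := P.le_dLCS_drop_zeros x hx hsx hn (x₁.length + x₂.length) (n * P.γ₄)
  rw [← hX, ← hx₁] at b₁
  rw [← hX, ← hx₃] at b₃
  obtain ⟨A, hA, b₂⟩ := P.exists_alignment_le_dLCS_slice x hx hsx hn hℓx hℓ hm y hy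
    (a := x₁.length) (l := x₂.length) (by rw [← hX]; omega)
  rw [← hX, ← hx₂] at b₂
  refine ⟨A, hA, ?_⟩
  have k0 := dLCS_add X (P.gadgetY n (List.ofFn y))
  have k1 := dLCS_add x₁ (zeros (n * P.γ₄))
  have k2 := dLCS_add x₂ (P.gadgetX (List.ofFn y))
  have k3 := dLCS_add x₃ (zeros (n * P.γ₄))
  rw [← hX]
  simp only [gadgetY, List.length_append, length_zeros, C] at k0 k1 k3 h₁ ⊢
  omega

end lower

/-! ### Lemma 4.3 -/

/-- **The alignment gadget for LCS on binary strings (Bringmann–Künnemann, FOCS 2015, Lemma 4.3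
with Def. 4.2; Def. 3.1 of an alignment gadget).** Let `1 ≤ m ≤ n`, let `x₁, …, x_n` be bit
strings of one type `(ℓₓ, sₓ)` with `ℓₓ ≥ 1` and `y₁, …, y_m` bit strings of one length
`ℓ_y ≥ ℓₓ`, `P = (ℓₓ, ℓ_y, sₓ)`, `x = G(x₁) 0^{γ₃} ⋯ G(x_n)`,
`y = 0^{nγ₄} G(y₁) 0^{γ₃} ⋯ G(y_m) 0^{nγ₄}`, `C = 2nγ₄`. Then for `δ = δ_LCS`:
(i) `δ(x, y) ≤ C + ∑_{j<m} δ(x_{Δ+j}, yⱼ)` for every `0 ≤ Δ ≤ n - m`;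
(ii) there is an alignment `A ∈ 𝒜_{n,m}` with `C + δ(A) ≤ δ(x, y)`,
i.e. `min_{A ∈ 𝒜} δ(A) ≤ δ(x,y) - C ≤ min_{A ∈ 𝒮} δ(A)` — `(x, y, C)` realises an alignment gadget.
The side conditions are discussed in the module docstring.
[cite: BringmannKunnemannFOCS2015, Lemma 4.3 (with Def. 4.2 and Def. 3.1)] -/
theorem alignmentGadget_dLCS (n m : ℕ) (P : Params) (x : Fin n → List Bool) (y : Fin m → List Bool)
    (hm : 1 ≤ m) (hmn : m ≤ n) (hℓx : 1 ≤ P.ℓx) (hℓ : P.ℓx ≤ P.ℓy)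
    (hx : ∀ i, (x i).length = P.ℓx) (hsx : ∀ i, (x i).count true = P.sx)
    (hy : ∀ j, (y j).length = P.ℓy) :
    (∀ (Δ : ℕ) (hΔ : Δ + m ≤ n),
        dLCS (P.gadgetX (List.ofFn x)) (P.gadgetY n (List.ofFn y)) ≤
          P.C n + structuredCostL x y Δ hΔ) ∧
    (∃ A : List (Fin n × Fin m), IsAlignment A ∧
        P.C n + alignCostL x y A ≤ dLCS (P.gadgetX (List.ofFn x)) (P.gadgetY n (List.ofFn y))) :=
  ⟨fun Δ hΔ => P.dLCS_gadget_le_structuredCost x hx hsx hm y hy Δ hΔ,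
    P.exists_alignment_le_dLCS_gadget x hx hsx hℓx hℓ hm hmn y hy⟩

end Params

end BKLCS

end Literature.Computability.FineGrained
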